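import Summits.SmoothPoincare4.SmoothPoincare4.Theses.SymplecticOrigami
import Summits.SmoothPoincare4.SmoothPoincare4.Theses.SchoenfliesSplit
import Summits.SmoothPoincare4.SmoothPoincare4.Theses.EuclideanOrigami
import Summits.SmoothPoincare4.SmoothPoincare4.Theorems.SchsplitCerf.Negative.RefutationCost
import Literature.Topology.FourManifolds.CerfGammaFourProofs
import Literature.Topology.FourManifolds.BallGluingUniqueness
import Literature.Topology.FourManifolds.RadialExtension
import Literature.Topology.FourManifolds.CerfTheoremOne
import Literature.Topology.FourManifolds.SmoothOrientationSphereProofs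
import Literature.Topology.FourManifolds.SmoothOrientationDiffeomorphProofs
import Literature.Topology.FourManifolds.ClosedBallSmoothMaps
import Literature.Geometry.Symplectic.GromovR4RelEndProofs
import Summits.SmoothPoincare4.SmoothPoincare4.Theorems.SymplecticOrigamiSchsplitCerfStubConePullbackLiouville
import Summits.SmoothPoincare4.SmoothPoincare4.Theorems.SymplecticOrigamiSchsplitCerfStubSymplecticOfLiouville
import Summits.SmoothPoincare4.SmoothPoincare4.Theorems.SymplecticOrigamiSchsplitCerfStubConeRelEnd
import Summits.SmoothPoincare4.SmoothPoincare4.Theorems.SymplecticOrigamiSchsplitCerfStubRadialDiffeomorph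
import Summits.SmoothPoincare4.SmoothPoincare4.Theorems.SymplecticOrigamiSchsplitCerfStubConeGermExtendsOverBall
import HarnessLib.Audit

/-!
# Line `contact-isotopy-gromov-cone` — ASSEMBLY for crux `SchsplitCerf` (stmt-SmoothPoincare4-8758)

Crux (FIXED, never restated): `SchoenfliesSplit.SchsplitCerf` = `SymplecticOrigami.CerfGammaFour` =
`EuclideanOrigami.SchsplitCerf` = VERBATIM the tree's named fact
`Literature.Topology.FourManifolds.cerf_twistedSphere_four` (Cerf 1968, `Γ₄ = 0` in twisted-sphere
form: every `D⁴ ∪_φ D⁴` is diffeomorphic to `S⁴`).  Primary route of this chain: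
`route-SmoothPoincare4-SymplecticOrigami`; shared with SchoenfliesSplit and EuclideanOrigami.
Idea card `Cruxes/SchsplitCerf/Ideas/contact-isotopy-gromov-cone.md` (ideator 1), merged by the
triage panel with `contact-cone-gromov-relend` (ideator 2); planner skeleton
`Cruxes/SchsplitCerf/Lines/contact_isotopy_gromov_cone.lean`; reshaped and made definition-free by
the line lead (prover-line-stmt-SmoothPoincare4-8758-0, 2026-08-16).  All five registered
stubs are LANDED Theorems files imported below: `…StubConePullbackLiouville` (p84760),
`…StubSymplecticOfLiouville` (p84152), `…StubConeRelEnd` (p85844), `…StubRadialDiffeomorph`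
(p84860), `…StubConeGermExtendsOverBall` (p85124); this file is the sorry-free assembly.

## The line (Eliashberg's proof architecture of `Γ₄ = 0`, Geiges 2008 §1.7.1 / Prop. 4.11.2, with
## the filling-by-discs step replaced by the tree's relative recognition of `(ℝ⁴, ω₀)`)

* **K1 = named-fact premise = route item `SymplecticOrigami.ContactRepresentative`**
  (stmt-SmoothPoincare4-14580; Geiges 2008, Lemma 4.11.1 + positivity of the conformal factor:
  every orientation-preserving `f ∈ Diff S³` is diffeotopic to `g` with `g^*α₀ = e^u α₀`,
  `α₀_z(v) = ½ ω₀(z, v)` read through `mfderiv` of the inclusion `S³ ↪ ℝ⁴`).  Hypothesis `hE` of the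
  composition, taken BY NAME; never a stub.
* **Z1 (symplectic cone)** = registered stubs `stub_conePullbackLiouville` (Z1a: the rescaled cone
  `C(y) = ‖y‖ e^{-u(ŷ)/2} φ(ŷ)` of a positive contactomorphism satisfies `C^*λ₀ = λ₀` off `0`, i.e.
  `ω₀(C x, DC_x w) = ω₀(x, w)`) and `stub_symplectic_of_liouville` (Z1b: `d` of that identity for any
  map `C^∞` on an open set), glued by the PROVED `symplecticCone`; smoothness of the cone off the
  origin is PROVED (`contDiffAt_of_eq_cone`).
* **Z2** = registered stub `stub_coneRelEnd` (four hypotheses on `(ψ, h, C)`; smoothness of `C` off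
  `0` is derived inside, not assumed): under the named fact `gromov_recognitionR4_relEnd`
  (= route item `SymplecticOrigami.GromovRecognitionRelEnd`, stmt-11009, hypothesis `hG`) the data
  `(ℝ⁴, ω₀, K = {‖C x‖ ≤ 1}, R = 1, ψ = C, χ = explicit inverse)` satisfy its ten hypotheses, so
  there is `Φ ∈ Diff ℝ⁴` with `Φ = C` off a compact set (only the diffeomorphism half is exported).
* **Z3** = registered stubs `stub_radialDiffeomorph` (Z3a: `x ↦ g(x) • x` is a diffeomorphism of
  `ℝ⁴` for `g > 0` smooth with `0 ≤ Dg_x(x)`) and `stub_coneGerm_extendsOverBall` (Z3b: conical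
  rescaling + radial straightening turn `Φ` into a diffeomorphism of `𝔻⁴` restricting to `ψ`,
  `ExtendsOverBall 3 ψ`).
* **Glue (PROVED, sorry-free)**: Z1 ∧ Z2 ∧ Z3 ⟹ K2 (`contactomorphismsExtend_of_gromov`: positive
  contactomorphisms of `(S³, ξ_st)` extend over `D⁴` — Geiges Prop 4.11.2); K1 ∧ K2 ⟹
  `cerf_diffeomorph_sphere_three_extends_ball` (`cerf_extends_of_contact`: orientation split, Cerf's
  Lemme 2 `ExtendsOverBall.of_isDiffeotopic`, reflections extend linearly
  `extendsOverBall_sphereReflection`); then the tree's PROVED two-disc gluing uniqueness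
  `cerf_twistedSphere_four_of_extends''` gives the crux for all three route decls BY NAME
  (`SchsplitCerf_of`, `CerfGammaFour_of`, `SchsplitCerfEuclidean_of`) from the two route-item
  hypotheses `hE`, `hG` only.

Disproof.lean (cdisprove v2, 2026-08-16; no kill — a counterexample is an exotic `S⁴`) honoured:
§2 `schsplitCerf_of_extends` is this line's entry point; §3 `schsplitCerf_false_without_gluing` /
`_false_without_cover` — gluing predicate and cover clause are consumed inside
`cerf_twistedSphere_four_of_extends''`; §4(i) `not_forall_isDiffeotopicToId_sphere_three` —
`cerf_extends_of_contact` splits by orientation class, K1 quantifies over orientation-preserving `f`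
only; §4(iii) (`Γ₇ = ℤ/28`) — K1 is 3-dimensional contact topology, Z2 is 4-dimensional symplectic
rigidity.  Landed Negative lemma imported (`Negative.RefutationCost`): refutes no stub.  No stub
mentions `S⁴`, twisted spheres or `Diff(D³ rel ∂)`; none is SPC4-implied; no definitions are
introduced (the cone enters every statement as `(C, hC : ∀ y, C y = …)`).
-/

noncomputable section

-- the prescribed namespace `Summit.<P>.<Sub>.…` duplicates `SmoothPoincare4` (P = Sub)
set_option linter.dupNamespace false

open scoped Manifold ContDiff Topology
open Set Function Metric
open Literature.Topology.FourManifolds Literature.Geometry.Symplectic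

namespace Summit.SmoothPoincare4.SmoothPoincare4.Theorems.SchsplitCerf.ContactIsotopyGromovCone

attribute [local instance] Literature.Topology.FourManifolds.fact_finrank_euclideanSpace_succ

/-- The unit 3-sphere `S³ ⊂ ℝ⁴` (Mathlib's manifold structure, model `𝓡 3`). -/
local notation "𝕊³" => (Metric.sphere (0 : EuclideanSpace ℝ (Fin 4)) 1)
/-- The model `ℝ⁴`. -/
local notation "E4" => EuclideanSpace ℝ (Fin 4)

/-! ## The cone is smooth off the origin (proved) -/

/-- **The rescaled cone `C(y) = ‖y‖ · h(ŷ) · ψ(ŷ)` is `C^∞` away from the origin** when `h` is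
smooth (every constituent is: `‖·‖` off `0`, the radial projection into Mathlib's manifold `S³` off
`0` — `contMDiffAt_radialProjection` —, `h`, `ψ` and the inclusion `S³ ↪ ℝ⁴`).  Pointwise-formula
shape, as consumed by the registered stubs. [folklore] -/
theorem contDiffAt_of_eq_cone (ψ : 𝕊³ ≃ₘ⟮𝓡 3, 𝓡 3⟯ 𝕊³) (h : 𝕊³ → ℝ)
    (hh : ContMDiff (𝓡 3) 𝓘(ℝ, ℝ) ∞ h) {C : E4 → E4}
    (hC : ∀ y : E4, C y =
      (‖y‖ * h (radialProjection (sphereBasePoint 3) y)) •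
        ((ψ (radialProjection (sphereBasePoint 3) y) : 𝕊³) : E4)) {x : E4} (hx : x ≠ 0) :
    ContDiffAt ℝ ∞ C x := by
  have hC' : C = fun y : E4 => (‖y‖ * h (radialProjection (sphereBasePoint 3) y)) •
      ((ψ (radialProjection (sphereBasePoint 3) y) : 𝕊³) : E4) := funext hC
  rw [hC']
  have h1 : ContMDiffAt 𝓘(ℝ, E4) (𝓡 3) ∞ (radialProjection (sphereBasePoint 3)) x :=
    contMDiffAt_radialProjection _ hx
  have h2 : ContMDiffAt 𝓘(ℝ, E4) 𝓘(ℝ, ℝ) ∞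
      (fun y : E4 => h (radialProjection (sphereBasePoint 3) y)) x :=
    hh.contMDiffAt.comp x h1
  have h3 : ContMDiffAt 𝓘(ℝ, E4) 𝓘(ℝ, E4) ∞
      (fun y : E4 => ((ψ (radialProjection (sphereBasePoint 3) y) : 𝕊³) : E4)) x :=
    (contMDiff_coe_sphere.comp ψ.contMDiff).contMDiffAt.comp x h1
  exact ((contDiffAt_norm ℝ hx).mul (contMDiffAt_iff_contDiffAt.1 h2)).smul
    (contMDiffAt_iff_contDiffAt.1 h3)

/-! ## Z1 from the landed stubs Z1a, Z1b (all five registered stubs are imported Theorems files) -/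



/-- **Z1 (formerly the single stub `stub_symplecticCone`, now PROVED from Z1a + Z1b): the
rescaled cone of a positive contactomorphism is `ω₀`-symplectic off the origin.**
`C^*ω₀ = d(C^*λ₀) = dλ₀ = ω₀` on the open set `ℝ⁴ ∖ 0`.
[cite: Geiges2008, proof of Prop. 4.11.2 (symplectisation of a contactomorphism)] -/
theorem symplecticCone
    (φ : 𝕊³ ≃ₘ⟮𝓡 3, 𝓡 3⟯ 𝕊³) (u : 𝕊³ → ℝ) (C : E4 → E4)
    (hu : ContMDiff (𝓡 3) 𝓘(ℝ, ℝ) ∞ u)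
    (hφ : ∀ (z : 𝕊³) (v : TangentSpace (𝓡 3) z),
      stdSymplecticForm ((φ z : 𝕊³) : E4)
          (mfderiv (𝓡 3) 𝓘(ℝ, E4) (fun w : 𝕊³ => ((φ w : 𝕊³) : E4)) z v) =
        Real.exp (u z) *
          stdSymplecticForm ((z : 𝕊³) : E4)
            (mfderiv (𝓡 3) 𝓘(ℝ, E4) (fun w : 𝕊³ => ((w : 𝕊³) : E4)) z v))
    (hC : ∀ y : E4, C y =
      (‖y‖ * Real.exp (-(u (radialProjection (sphereBasePoint 3) y)) / 2)) •
        ((φ (radialProjection (sphereBasePoint 3) y) : 𝕊³) : E4)) :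
    ∀ x : E4, x ≠ 0 → ∀ v w : E4,
      stdSymplecticForm (fderiv ℝ C x v) (fderiv ℝ C x w) = stdSymplecticForm v w := by
  have hsm : ContMDiff (𝓡 3) 𝓘(ℝ, ℝ) ∞ (fun z : 𝕊³ => Real.exp (-(u z) / 2)) := by
    have hg : ContDiff ℝ ∞ (fun t : ℝ => Real.exp (-t / 2)) :=
      Real.contDiff_exp.comp (contDiff_neg.div_const 2)
    exact hg.comp_contMDiff hu
  have hCs : ∀ x : E4, x ≠ 0 → ContDiffAt ℝ ∞ C x := fun x hx =>
    contDiffAt_of_eq_cone φ (fun z : 𝕊³ => Real.exp (-(u z) / 2)) hsm hC hx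
  intro x hx
  exact stub_symplectic_of_liouville C {y : E4 | y ≠ 0} isOpen_ne (fun y hy => hCs y hy)
    (fun y hy w => stub_conePullbackLiouville φ u C hu hφ hC y hy w) x hx


/-! ## Glue (sorry-free): Z1 ∧ Z2 ∧ Z3 ⟹ K2;  K1 ∧ K2 ⟹ `Γ₄ = 0` in extension form ⟹ the crux -/

/-- **K2 — positive contactomorphisms of `(S³, ξ_st)` extend over `D⁴`** (Geiges 2008
Prop. 4.11.2 = Eliashberg 1992), here DERIVED from the registered stubs under Gromov's relative
recognition of `ℝ⁴`: cone the contactomorphism off with `h = e^{-u/2}` (Z1: symplectic off `0`),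
recognise `(ℝ⁴, ω₀)` relative to that end (Z2), rescale and straighten (Z3).
[cite: Geiges2008, Prop. 4.11.2] -/
theorem contactomorphismsExtend_of_gromov (hG : gromov_recognitionR4_relEnd)
    (φ : 𝕊³ ≃ₘ⟮𝓡 3, 𝓡 3⟯ 𝕊³) (u : 𝕊³ → ℝ) (hu : ContMDiff (𝓡 3) 𝓘(ℝ, ℝ) ∞ u)
    (hφ : ∀ (z : 𝕊³) (v : TangentSpace (𝓡 3) z),
      stdSymplecticForm ((φ z : 𝕊³) : E4)
          (mfderiv (𝓡 3) 𝓘(ℝ, E4) (fun w : 𝕊³ => ((φ w : 𝕊³) : E4)) z v) =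
        Real.exp (u z) *
          stdSymplecticForm ((z : 𝕊³) : E4)
            (mfderiv (𝓡 3) 𝓘(ℝ, E4) (fun w : 𝕊³ => ((w : 𝕊³) : E4)) z v)) :
    ExtendsOverBall 3 φ := by
  set h : 𝕊³ → ℝ := fun z => Real.exp (-(u z) / 2) with hh_def
  have hpos : ∀ z, 0 < h z := fun z => Real.exp_pos _
  have hsm : ContMDiff (𝓡 3) 𝓘(ℝ, ℝ) ∞ h := by
    have hg : ContDiff ℝ ∞ (fun t : ℝ => Real.exp (-t / 2)) :=
      Real.contDiff_exp.comp (contDiff_neg.div_const 2)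
    exact hg.comp_contMDiff hu
  set C : E4 → E4 := fun y =>
    (‖y‖ * h (radialProjection (sphereBasePoint 3) y)) •
      ((φ (radialProjection (sphereBasePoint 3) y) : 𝕊³) : E4) with hC_def
  have hC : ∀ y : E4, C y =
      (‖y‖ * Real.exp (-(u (radialProjection (sphereBasePoint 3) y)) / 2)) •
        ((φ (radialProjection (sphereBasePoint 3) y) : 𝕊³) : E4) := fun y => rfl
  have hC' : ∀ y : E4, C y =
      (‖y‖ * h (radialProjection (sphereBasePoint 3) y)) •
        ((φ (radialProjection (sphereBasePoint 3) y) : 𝕊³) : E4) := fun y => rfl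
  have hsymp := symplecticCone φ u C hu hφ hC
  obtain ⟨Φ, K', hK', hΦ⟩ := stub_coneRelEnd hG φ h C hsm hpos hC' hsymp
  exact stub_coneGerm_extendsOverBall stub_radialDiffeomorph φ h C hsm hpos hC' Φ ⟨K', hK', hΦ⟩

/-- **K1 ∧ K2 ⟹ every self-diffeomorphism of `S³` extends over `D⁴`** (Geiges 2008 §1.7.1, last
paragraph), with K1 the route item `SymplecticOrigami.ContactRepresentative` taken by name and K2 in
the inlined form produced by `contactomorphismsExtend_of_gromov`.  Orientation-preserving `φ`:
`g ∈ Ext` by K2 and `φ` is diffeotopic to `g` (`ExtendsOverBall.of_isDiffeotopic`, Cerf's Lemme 2).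
Orientation-reversing `φ`: the same for `φ ∘ ρ`, `ρ` a hyperplane reflection, which extends
linearly (`extendsOverBall_sphereReflection`). [cite: Geiges2008, §1.7.1] -/
theorem cerf_extends_of_contact
    (h1 : Summit.SmoothPoincare4.SmoothPoincare4.Theses.SymplecticOrigami.ContactRepresentative)
    (h2 : ∀ (φ : 𝕊³ ≃ₘ⟮𝓡 3, 𝓡 3⟯ 𝕊³) (u : 𝕊³ → ℝ), ContMDiff (𝓡 3) 𝓘(ℝ, ℝ) ∞ u →
      (∀ (z : 𝕊³) (v : TangentSpace (𝓡 3) z),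
        stdSymplecticForm ((φ z : 𝕊³) : E4)
            (mfderiv (𝓡 3) 𝓘(ℝ, E4) (fun w : 𝕊³ => ((φ w : 𝕊³) : E4)) z v) =
          Real.exp (u z) *
            stdSymplecticForm ((z : 𝕊³) : E4)
              (mfderiv (𝓡 3) 𝓘(ℝ, E4) (fun w : 𝕊³ => ((w : 𝕊³) : E4)) z v)) →
      ExtendsOverBall 3 φ) :
    cerf_diffeomorph_sphere_three_extends_ball := by
  intro φ
  obtain ⟨o, -⟩ := exists_smoothOrientation_sphere 3
  haveI : ConnectedSpace 𝕊³ := by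
    refine isConnected_iff_connectedSpace.mp (isConnected_sphere ?_ 0 zero_le_one)
    rw [← Module.finrank_eq_rank, finrank_euclideanSpace_fin]
    norm_num
  -- the orientation-preserving case, for any `θ`
  have hpos : ∀ θ : 𝕊³ ≃ₘ⟮𝓡 3, 𝓡 3⟯ 𝕊³, θ.IsOrientationPreserving o o → ExtendsOverBall 3 θ := by
    intro θ hθ
    obtain ⟨g, u, hg, hu, hcontact⟩ := h1 o θ hθ
    exact (h2 g u hu hcontact).of_isDiffeotopic hg
  rcases Diffeomorph.isOrientationPreserving_or_isOrientationReversing_holds φ (by simp) o o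
    with hφ | hφ
  · exact hpos φ hφ
  · set v : 𝕊³ := sphereBasePoint 3
    have hρ : IsOrientationPreserving o (-o) ⇑(sphereReflection v) :=
      sphereReflection_isOrientationReversing_of_ne_zero three_ne_zero v o
    have hφ' : IsOrientationPreserving (-o) o ⇑φ := by
      rw [← isOrientationPreserving_neg_neg_iff, neg_neg]
      exact hφ
    have hcomp : ((sphereReflection v).trans φ).IsOrientationPreserving o o := by
      show IsOrientationPreserving o o ⇑((sphereReflection v).trans φ)
      rw [Diffeomorph.coe_trans]
      exact IsOrientationPreserving.comp_holds hφ' hρ (φ.mdifferentiable (by simp))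
        ((sphereReflection v).mdifferentiable (by simp))
        (fun y => φ.det_mfderiv_ne_zero (by simp) y)
        (fun x => (sphereReflection v).det_mfderiv_ne_zero (by simp) x)
    have hext : ExtendsOverBall 3 ((sphereReflection v).trans φ) := hpos _ hcomp
    have key : φ = (sphereReflection v).symm.trans ((sphereReflection v).trans φ) :=
      Diffeomorph.ext fun x => by
        simp only [Diffeomorph.coe_trans, Function.comp_apply, Diffeomorph.apply_symm_apply]
    rw [key]
    exact (extendsOverBall_sphereReflection v).symm.trans hext


/-- The route item `GromovRecognitionRelEnd` (stmt-SmoothPoincare4-11009) is literally the tree's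
named fact `gromov_recognitionR4_relEnd`. [folklore] -/
theorem gromovRecognitionRelEnd_iff :
    Summit.SmoothPoincare4.SmoothPoincare4.Theses.SymplecticOrigami.GromovRecognitionRelEnd ↔
      gromov_recognitionR4_relEnd :=
  Iff.rfl

/-- **`Γ₄ = 0` in extension form from the two named-fact route items** `ContactRepresentative`
(K1, stmt-14580, Eliashberg) and `GromovRecognitionRelEnd` (stmt-11009, Gromov–McDuff rel end).
[cite: Geiges2008, §1.7.1] -/
theorem cerf_extends_of_gromov
    (hE : Summit.SmoothPoincare4.SmoothPoincare4.Theses.SymplecticOrigami.ContactRepresentative)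
    (hG : Summit.SmoothPoincare4.SmoothPoincare4.Theses.SymplecticOrigami.GromovRecognitionRelEnd) :
    cerf_diffeomorph_sphere_three_extends_ball :=
  cerf_extends_of_contact hE (contactomorphismsExtend_of_gromov (gromovRecognitionRelEnd_iff.1 hG))

/-! ## Composition: the crux BY NAME (all three route decls), hypotheses = route items only -/

/-- **The crux of route SchoenfliesSplit (`SchsplitCerf`, stmt-8758) from the registered stubs, under
the two named-fact route items `ContactRepresentative` (K1 = stmt-14580, Eliashberg) and
`GromovRecognitionRelEnd` (stmt-11009, Gromov–McDuff rel end)**, via the tree's proved two-disc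
gluing uniqueness `cerf_twistedSphere_four_of_extends''`.
[cite: CerfDiffeoSphere1968, Ch. I §1, Corollaire 1] -/
theorem SchsplitCerf_of
    (hE : Summit.SmoothPoincare4.SmoothPoincare4.Theses.SymplecticOrigami.ContactRepresentative)
    (hG : Summit.SmoothPoincare4.SmoothPoincare4.Theses.SymplecticOrigami.GromovRecognitionRelEnd) :
    Summit.SmoothPoincare4.SmoothPoincare4.Theses.SchoenfliesSplit.SchsplitCerf :=
  cerf_twistedSphere_four_of_extends'' (cerf_extends_of_gromov hE hG)

/-- **The same crux under its SymplecticOrigami name `CerfGammaFour`.**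
[cite: CerfDiffeoSphere1968, Ch. I §1, Corollaire 1] -/
theorem CerfGammaFour_of
    (hE : Summit.SmoothPoincare4.SmoothPoincare4.Theses.SymplecticOrigami.ContactRepresentative)
    (hG : Summit.SmoothPoincare4.SmoothPoincare4.Theses.SymplecticOrigami.GromovRecognitionRelEnd) :
    Summit.SmoothPoincare4.SmoothPoincare4.Theses.SymplecticOrigami.CerfGammaFour :=
  cerf_twistedSphere_four_of_extends'' (cerf_extends_of_gromov hE hG)

/-- **The same crux under its EuclideanOrigami name `SchsplitCerf`.**
[cite: CerfDiffeoSphere1968, Ch. I §1, Corollaire 1] -/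
theorem SchsplitCerfEuclidean_of
    (hE : Summit.SmoothPoincare4.SmoothPoincare4.Theses.SymplecticOrigami.ContactRepresentative)
    (hG : Summit.SmoothPoincare4.SmoothPoincare4.Theses.SymplecticOrigami.GromovRecognitionRelEnd) :
    Summit.SmoothPoincare4.SmoothPoincare4.Theses.EuclideanOrigami.SchsplitCerf :=
  cerf_twistedSphere_four_of_extends'' (cerf_extends_of_gromov hE hG)

/-! ## Sanity: non-vacuity of the stub hypotheses (the identity is a positive contactomorphism with
`u = 0`; its rescaled cone is the identity off `0`) -/

/-- The contact clause holds for `φ = id`, `u = 0`. -/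
example : ∀ (z : 𝕊³) (v : TangentSpace (𝓡 3) z),
    stdSymplecticForm (((Diffeomorph.refl (𝓡 3) 𝕊³ ∞) z : 𝕊³) : E4)
        (mfderiv (𝓡 3) 𝓘(ℝ, E4) (fun w : 𝕊³ => (((Diffeomorph.refl (𝓡 3) 𝕊³ ∞) w : 𝕊³) : E4)) z v) =
      Real.exp ((0 : 𝕊³ → ℝ) z) *
        stdSymplecticForm ((z : 𝕊³) : E4)
          (mfderiv (𝓡 3) 𝓘(ℝ, E4) (fun w : 𝕊³ => ((w : 𝕊³) : E4)) z v) :=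
  fun z v => by rw [Pi.zero_apply, Real.exp_zero, one_mul]; rfl

/-- The cone of `(id, 1)` is the identity of `ℝ⁴`, so the data of Z2/Z3 are jointly satisfiable
(`ψ = id, h = 1, C = id, Φ = refl, K' = ∅`). -/
example (y : E4) :
    (‖y‖ * (fun _ : 𝕊³ => (1 : ℝ)) (radialProjection (sphereBasePoint 3) y)) •
      (((Diffeomorph.refl (𝓡 3) 𝕊³ ∞) (radialProjection (sphereBasePoint 3) y) : 𝕊³) : E4) = y := by
  rw [Diffeomorph.coe_refl, id, mul_one, norm_smul_coe_radialProjection]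

end Summit.SmoothPoincare4.SmoothPoincare4.Theorems.SchsplitCerf.ContactIsotopyGromovCone

end
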